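import Mathlib
import Literature.Analysis.FluidPDE.AxisymmetricEuler
import Literature.Analysis.FluidPDE.AxisymPoloidalMoments
import HarnessLib

/-!
# Crux `EulerZoomLiouville.PowerGaugeEulerLiouville` (stmt-NavierStokesRegularity-19832), width sub-line `casimir_haul` (ns-idea-11, REV2),
# stub H4a `stub_haulTravel` — part (a): THE PRODUCT CUT-OFF `ψ_b(x) = ζ(x₂/b)·χ((x₀²+x₁²)/b²)` (pure calculus tools)

Seat ns-sfl-p1 g10 (`--supports stmt-NavierStokesRegularity-19832 --as helper`).  H4a (`Lines/casimir_haul.lean` REV2, ns-idea-11 g11) is the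
TRAVEL INEQUALITY of the haul race: the volume of a blob `S ⊆ B̄(0,b/4)` is recovered at any earlier time `s₁` from the part of its image still in
`B(0,3b)` plus `K/b` times the time-integrated axial flux through the solid cylinder `{r < 2b, |x₂| < b}` and the traffic through the shell
`{b ≤ r, |x| < 3b}`.  The instrument is a PRODUCT CUT-OFF built from two fixed one-dimensional bumps `ζ, χ : ContDiffBump (0 : ℝ)`
(`ζ = 1` on `|z| ≤ ½`, `supp ζ ⊆ (−1,1)`; `χ = 1` on `|q| ≤ 1`, `supp χ ⊆ (−4,4)`):
`ψ_b(x) = ζ(x₂/b) · χ((x₀² + x₁²)/b²)` — equal to `1` on `B̄(0,b/4)`, supported in the solid cylinder (inside `B(0,3b)`), with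
`∇ψ_b · v = (1/b) ζ′(x₂/b) v₂` on the core `r < b` and `|∇ψ_b · v − (1/b)𝟙_{cyl} ζ′(x₂/b) v₂| ≤ ((C_ζ + 4C_χ)/b) 𝟙_{shell} ‖v‖` everywhere.
This file is class-free real analysis (no fluid object appears); part (b) (`…CasimirHaulTravel`) integrates it along a ledger flow.

* `deriv_eq_zero_of_bump_eq_zero` — a bump's derivative vanishes wherever the bump does (global minimum of a nonnegative function);
* `hasDerivWithinAt_productCutoff_comp` — the chain rule for `σ ↦ ψ_b(γ σ)` along any curve with a one-sided derivative;
* `productCutoff_eq_one_of_mem_closedBall`, `productCutoff_nonneg_le_one`, `productCutoff_le_indicator_ball`, `coord_bounds`, `exists_bound_deriv_bump` — values of `ψ_b`;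
* ★ `abs_productCutoffRate_sub_axial_le` — the pointwise CORE/SHELL SPLIT of the rate `∇ψ_b(y)·v`; `abs_productCutoffRate_le` — crude bound;
* `map_restrict_eq_of_lintegral_comp`, `setIntegral_image_eq_of_lintegral_comp` — the `ℝ≥0∞` change of variables of a ledger flow
  (clause 6 of `IsLedgerFlow`) as the push-forward identity `X_*(vol⌊S) = vol⌊(X '' S)` and its real-valued form.

HONEST FRAMING: calculus for a width sub-line of the crux class; nothing here bears on the crux E (19832 OPEN) or on NS regularity; not E.
[folklore; cite: MajdaBertozziCUP2002, §1.3 Prop. 1.4 (transport of cut-offs along particle trajectories)]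
-/

noncomputable section

-- flat `Theorems/<Route><Decl>…` files of one crux share the namespace of the crux (tree convention)
set_option linter.dupNamespace false

open MeasureTheory Set Filter Topology Metric Function
open scoped NNReal ENNReal Topology

namespace Summit.NavierStokesRegularity.NavierStokesRegularity.Theorems.PowerGaugeEulerLiouville.CasimirHaul

open Literature.Analysis Literature.Analysis.FluidPDE

/-- A bump's derivative vanishes wherever the bump vanishes: a zero of a nonnegative `C¹` function is a global minimum. [folklore] -/
theorem deriv_eq_zero_of_bump_eq_zero (ζ : ContDiffBump (0 : ℝ)) {z : ℝ} (hz : ζ z = 0) : deriv ζ z = 0 := by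
  have hmin : IsLocalMin (ζ : ℝ → ℝ) z :=
    Filter.Eventually.of_forall fun y => by rw [hz]; exact ζ.nonneg
  exact hmin.deriv_eq_zero

/-- A bump's derivative vanishes on the open plateau `|z| < rIn`. [folklore] -/
theorem deriv_eq_zero_of_bump_mem_ball (ζ : ContDiffBump (0 : ℝ)) {z : ℝ} (hz : z ∈ ball (0 : ℝ) ζ.rIn) : deriv ζ z = 0 := by
  rw [(ζ.eventuallyEq_one_of_mem_ball hz).deriv_eq]
  exact deriv_const z 1

/-- A bump on `ℝ` has a bounded derivative. [folklore] -/
theorem exists_bound_deriv_bump (ζ : ContDiffBump (0 : ℝ)) : ∃ C : ℝ, 0 ≤ C ∧ ∀ z : ℝ, |deriv ζ z| ≤ C := by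
  have hc : Continuous (deriv ζ) := (ζ.contDiff (n := 1)).continuous_deriv le_rfl
  have hsupp : HasCompactSupport (deriv ζ) := ζ.hasCompactSupport.deriv
  obtain ⟨C, hC⟩ := hsupp.exists_bound_of_continuous hc
  exact ⟨max C 0, le_max_right _ _, fun z => (Real.norm_eq_abs _ ▸ hC z).trans (le_max_left _ _)⟩

/-- **Chain rule for the product cut-off along a curve**: if `γ` has the one-sided derivative `γ′` at `σ` within `T`, then
`σ ↦ ζ(γ₂/b)·χ((γ₀²+γ₁²)/b²)` has derivative `ζ′(γ₂/b)(γ′₂/b)χ(q) + ζ(γ₂/b)χ′(q)(2γ₀γ′₀ + 2γ₁γ′₁)/b²` there (`q = (γ₀²+γ₁²)/b²`). [folklore] -/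
theorem hasDerivWithinAt_productCutoff_comp (ζ χ : ContDiffBump (0 : ℝ)) (b : ℝ)
    {γ : ℝ → EuclideanSpace ℝ (Fin 3)} {γ' : EuclideanSpace ℝ (Fin 3)} {T : Set ℝ} {σ : ℝ} (hγ : HasDerivWithinAt γ γ' T σ) :
    HasDerivWithinAt (fun σ => ζ ((γ σ) 2 / b) * χ (((γ σ) 0 ^ 2 + (γ σ) 1 ^ 2) / b ^ 2))
      (deriv ζ ((γ σ) 2 / b) * (γ' 2 / b) * χ (((γ σ) 0 ^ 2 + (γ σ) 1 ^ 2) / b ^ 2) +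
        ζ ((γ σ) 2 / b) *
          (deriv χ (((γ σ) 0 ^ 2 + (γ σ) 1 ^ 2) / b ^ 2) * ((2 * (γ σ) 0 * γ' 0 + 2 * (γ σ) 1 * γ' 1) / b ^ 2))) T σ := by
  -- coordinates of the curve
  have hcoord : ∀ i : Fin 3, HasDerivWithinAt (fun σ => (γ σ) i) (γ' i) T σ := fun i =>
    ((EuclideanSpace.proj i : EuclideanSpace ℝ (Fin 3) →L[ℝ] ℝ).hasFDerivAt.comp_hasDerivWithinAt σ hγ)
  -- the two arguments
  have h2 : HasDerivWithinAt (fun σ => (γ σ) 2 / b) (γ' 2 / b) T σ := (hcoord 2).div_const b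
  have hq : HasDerivWithinAt (fun σ => ((γ σ) 0 ^ 2 + (γ σ) 1 ^ 2) / b ^ 2)
      ((2 * (γ σ) 0 * γ' 0 + 2 * (γ σ) 1 * γ' 1) / b ^ 2) T σ := by
    have h0 := (hcoord 0).pow 2
    have h1 := (hcoord 1).pow 2
    have := (h0.add h1).div_const (b ^ 2)
    refine this.congr_deriv ?_
    simp only [Nat.cast_ofNat]
    ring
  -- the bumps are `C¹`
  have hζd : ∀ z, HasDerivAt (ζ : ℝ → ℝ) (deriv ζ z) z := fun z =>
    (((ζ.contDiff (n := 1)).differentiable one_ne_zero) z).hasDerivAt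
  have hχd : ∀ z, HasDerivAt (χ : ℝ → ℝ) (deriv χ z) z := fun z =>
    (((χ.contDiff (n := 1)).differentiable one_ne_zero) z).hasDerivAt
  have hA : HasDerivWithinAt (fun σ => ζ ((γ σ) 2 / b)) (deriv ζ ((γ σ) 2 / b) * (γ' 2 / b)) T σ :=
    (hζd _).comp_hasDerivWithinAt σ h2
  have hB : HasDerivWithinAt (fun σ => χ (((γ σ) 0 ^ 2 + (γ σ) 1 ^ 2) / b ^ 2))
      (deriv χ (((γ σ) 0 ^ 2 + (γ σ) 1 ^ 2) / b ^ 2) * ((2 * (γ σ) 0 * γ' 0 + 2 * (γ σ) 1 * γ' 1) / b ^ 2)) T σ :=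
    (hχd _).comp_hasDerivWithinAt σ hq
  exact hA.mul hB

/-- `|x₂| ≤ ‖x‖` and `x₀² + x₁² ≤ ‖x‖²` in `ℝ³`. [folklore] -/
theorem coord_bounds (x : EuclideanSpace ℝ (Fin 3)) : |x 2| ≤ ‖x‖ ∧ x 0 ^ 2 + x 1 ^ 2 ≤ ‖x‖ ^ 2 := by
  have hsq : ‖x‖ ^ 2 = x 0 ^ 2 + x 1 ^ 2 + x 2 ^ 2 := by
    rw [EuclideanSpace.norm_sq_eq, Fin.sum_univ_three]
    simp only [Real.norm_eq_abs, sq_abs]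
  refine ⟨abs_le_of_sq_le_sq (by rw [hsq]; nlinarith [sq_nonneg (x 0), sq_nonneg (x 1)]) (norm_nonneg _), ?_⟩
  rw [hsq]; nlinarith [sq_nonneg (x 2)]

/-- `ψ_b = 1` on `B̄(0, b/4)` when `ζ.rIn = ½`, `χ.rIn = 1` (`|x₂| ≤ ‖x‖ ≤ b/4`, `r² ≤ ‖x‖² ≤ b²/16`). [folklore] -/
theorem productCutoff_eq_one_of_mem_closedBall (ζ χ : ContDiffBump (0 : ℝ)) (hζ : ζ.rIn = 1 / 2) (hχ : χ.rIn = 1) {b : ℝ} (hb : 0 < b)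
    {x : EuclideanSpace ℝ (Fin 3)} (hx : x ∈ closedBall (0 : EuclideanSpace ℝ (Fin 3)) (b / 4)) :
    ζ (x 2 / b) * χ ((x 0 ^ 2 + x 1 ^ 2) / b ^ 2) = 1 := by
  have hxn : ‖x‖ ≤ b / 4 := mem_closedBall_zero_iff.1 hx
  obtain ⟨h2, hr⟩ := coord_bounds x
  have hζ1 : ζ (x 2 / b) = 1 := by
    apply ζ.one_of_mem_closedBall
    rw [mem_closedBall, dist_zero_right, Real.norm_eq_abs, abs_div, abs_of_pos hb, hζ, div_le_iff₀ hb]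
    linarith
  have hχ1 : χ ((x 0 ^ 2 + x 1 ^ 2) / b ^ 2) = 1 := by
    apply χ.one_of_mem_closedBall
    have hb2 : 0 < b ^ 2 := by positivity
    rw [mem_closedBall, dist_zero_right, Real.norm_eq_abs, abs_div, abs_of_pos hb2, hχ, div_le_iff₀ hb2,
      abs_of_nonneg (by positivity)]
    have : ‖x‖ ^ 2 ≤ (b / 4) ^ 2 := pow_le_pow_left₀ (norm_nonneg _) hxn 2
    nlinarith
  rw [hζ1, hχ1, mul_one]

/-- `0 ≤ ψ_b ≤ 1`. [folklore] -/
theorem productCutoff_nonneg_le_one (ζ χ : ContDiffBump (0 : ℝ)) (b : ℝ) (x : EuclideanSpace ℝ (Fin 3)) :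
    0 ≤ ζ (x 2 / b) * χ ((x 0 ^ 2 + x 1 ^ 2) / b ^ 2) ∧ ζ (x 2 / b) * χ ((x 0 ^ 2 + x 1 ^ 2) / b ^ 2) ≤ 1 :=
  ⟨mul_nonneg ζ.nonneg χ.nonneg, mul_le_one₀ ζ.le_one χ.nonneg χ.le_one⟩

/-- `ψ_b` lives in `B(0, 3b)` when `ζ.rOut = 1`, `χ.rOut = 4`: if `ψ_b(x) ≠ 0` then `|x₂| < b` and `r² < 4b²`, so `‖x‖² < 5b² < 9b²`;
hence `ψ_b ≤ 𝟙_{B(0,3b)}`. [folklore] -/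
theorem productCutoff_le_indicator_ball (ζ χ : ContDiffBump (0 : ℝ)) (hζ : ζ.rOut = 1) (hχ : χ.rOut = 4) {b : ℝ} (hb : 0 < b)
    (x : EuclideanSpace ℝ (Fin 3)) :
    ζ (x 2 / b) * χ ((x 0 ^ 2 + x 1 ^ 2) / b ^ 2) ≤ (ball (0 : EuclideanSpace ℝ (Fin 3)) (3 * b)).indicator (fun _ => (1 : ℝ)) x := by
  by_cases hx : x ∈ ball (0 : EuclideanSpace ℝ (Fin 3)) (3 * b)
  · rw [indicator_of_mem hx]; exact (productCutoff_nonneg_le_one ζ χ b x).2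
  · rw [indicator_of_notMem hx]
    -- outside `B(0,3b)` one of the two factors vanishes
    have hxn : 3 * b ≤ ‖x‖ := not_lt.1 fun h => hx (mem_ball_zero_iff.2 h)
    have hsq : ‖x‖ ^ 2 = x 0 ^ 2 + x 1 ^ 2 + x 2 ^ 2 := by
      rw [EuclideanSpace.norm_sq_eq, Fin.sum_univ_three]
      simp only [Real.norm_eq_abs, sq_abs]
    have h9 : 9 * b ^ 2 ≤ x 0 ^ 2 + x 1 ^ 2 + x 2 ^ 2 := by rw [← hsq]; nlinarith
    by_cases h2 : b ≤ |x 2|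
    · have : ζ (x 2 / b) = 0 := by
        apply ζ.zero_of_le_dist
        rw [dist_zero_right, Real.norm_eq_abs, abs_div, abs_of_pos hb, hζ, le_div_iff₀ hb]; linarith
      rw [this, zero_mul]
    · have h2' : x 2 ^ 2 < b ^ 2 := by
        have := not_le.1 h2
        calc x 2 ^ 2 = |x 2| ^ 2 := (sq_abs _).symm
          _ < b ^ 2 := pow_lt_pow_left₀ this (abs_nonneg _) two_ne_zero
      have : χ ((x 0 ^ 2 + x 1 ^ 2) / b ^ 2) = 0 := by
        apply χ.zero_of_le_dist
        have hb2 : 0 < b ^ 2 := by positivity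
        rw [dist_zero_right, Real.norm_eq_abs, abs_div, abs_of_pos hb2, hχ, le_div_iff₀ hb2, abs_of_nonneg (by positivity)]
        nlinarith
      rw [this, mul_zero]

/-- ★ **THE CORE/SHELL SPLIT of the rate `∇ψ_b(y)·v`** (`ζ.rOut = 1`, `χ.rIn = 1`, `χ.rOut = 4`, `|ζ′| ≤ C_ζ`, `|χ′| ≤ C_χ`, `b ≥ 1`):
`|∇ψ_b(y)·v − (1/b)·𝟙_{cyl}(y)·ζ′(y₂/b)·v₂| ≤ ((C_ζ + 4C_χ)/b)·𝟙_{shell}(y)·‖v‖` with `cyl = {r < 2b, |y₂| < b}` and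
`shell = {y ∈ B(0,3b), b ≤ r}`: on the core `r < b` the horizontal factor is `≡ 1` and the rate IS the axial term; for `b ≤ r < 2b`, `|y₂| < b`
both live in `cyl ∩ shell` (`‖y‖² < 5b²`) and `|∇χ-part| ≤ C_χ · 2r/b² ≤ 4C_χ/b`; for `r ≥ 2b` or `|y₂| ≥ b` everything vanishes. [folklore] -/
theorem abs_productCutoffRate_sub_axial_le (ζ χ : ContDiffBump (0 : ℝ)) (hζo : ζ.rOut = 1) (hχi : χ.rIn = 1)
    (hχo : χ.rOut = 4) {Cζ Cχ : ℝ} (hCζ : ∀ z, |deriv ζ z| ≤ Cζ) (hCχ : ∀ z, |deriv χ z| ≤ Cχ) {b : ℝ} (hb : 1 ≤ b)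
    (y v : EuclideanSpace ℝ (Fin 3)) :
    |(deriv ζ (y 2 / b) * (v 2 / b) * χ ((y 0 ^ 2 + y 1 ^ 2) / b ^ 2) +
        ζ (y 2 / b) * (deriv χ ((y 0 ^ 2 + y 1 ^ 2) / b ^ 2) * ((2 * y 0 * v 0 + 2 * y 1 * v 1) / b ^ 2))) -
      (1 / b) * {x : EuclideanSpace ℝ (Fin 3) | cylRadius x < 2 * b ∧ |x 2| < b}.indicator (fun x => deriv ζ (x 2 / b) * v 2) y| ≤
      (Cζ + 4 * Cχ) / b *
        {x : EuclideanSpace ℝ (Fin 3) | x ∈ ball (0 : EuclideanSpace ℝ (Fin 3)) (3 * b) ∧ b ≤ cylRadius x}.indicator (fun _ => ‖v‖) y := by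
  have hb0 : 0 < b := by linarith
  have hb2 : 0 < b ^ 2 := by positivity
  have hCζ0 : 0 ≤ Cζ := (abs_nonneg _).trans (hCζ 0)
  have hCχ0 : 0 ≤ Cχ := (abs_nonneg _).trans (hCχ 0)
  have hRHS0 : 0 ≤ (Cζ + 4 * Cχ) / b *
      {x : EuclideanSpace ℝ (Fin 3) | x ∈ ball (0 : EuclideanSpace ℝ (Fin 3)) (3 * b) ∧ b ≤ cylRadius x}.indicator (fun _ => ‖v‖) y :=
    mul_nonneg (by positivity) (indicator_nonneg (fun _ _ => norm_nonneg _) _)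
  set q : ℝ := (y 0 ^ 2 + y 1 ^ 2) / b ^ 2 with hq
  have hr2 : cylRadius y ^ 2 = y 0 ^ 2 + y 1 ^ 2 := cylRadius_sq y
  have hr0 : 0 ≤ cylRadius y := cylRadius_nonneg y
  have hsq : ‖y‖ ^ 2 = y 0 ^ 2 + y 1 ^ 2 + y 2 ^ 2 := by
    rw [EuclideanSpace.norm_sq_eq, Fin.sum_univ_three]
    simp only [Real.norm_eq_abs, sq_abs]
  by_cases h2 : b ≤ |y 2|
  · -- `|y₂| ≥ b`: the vertical bump and its derivative vanish, the axial indicator is off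
    have hz : ζ (y 2 / b) = 0 := by
      apply ζ.zero_of_le_dist
      rw [dist_zero_right, Real.norm_eq_abs, abs_div, abs_of_pos hb0, hζo, le_div_iff₀ hb0]; linarith
    have hz' : deriv ζ (y 2 / b) = 0 := deriv_eq_zero_of_bump_eq_zero ζ hz
    have hcyl : y ∉ {x : EuclideanSpace ℝ (Fin 3) | cylRadius x < 2 * b ∧ |x 2| < b} := fun h => by
      simp only [mem_setOf_eq] at h; linarith [h.2]
    rw [indicator_of_notMem hcyl, hz, hz']
    simpa using hRHS0
  have h2' : |y 2| < b := not_le.1 h2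
  by_cases hR : 2 * b ≤ cylRadius y
  · -- `r ≥ 2b`: the horizontal bump and its derivative vanish, the axial indicator is off
    have hq4 : 4 ≤ q := by
      rw [hq, le_div_iff₀ hb2, ← hr2]; nlinarith
    have hc : χ q = 0 := by
      apply χ.zero_of_le_dist
      rw [dist_zero_right, Real.norm_eq_abs, hχo, abs_of_nonneg (by rw [hq]; positivity)]; exact hq4
    have hc' : deriv χ q = 0 := deriv_eq_zero_of_bump_eq_zero χ hc
    have hcyl : y ∉ {x : EuclideanSpace ℝ (Fin 3) | cylRadius x < 2 * b ∧ |x 2| < b} := fun h => by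
      simp only [mem_setOf_eq] at h; linarith [h.1]
    rw [indicator_of_notMem hcyl, hc, hc']
    simpa using hRHS0
  have hR' : cylRadius y < 2 * b := not_le.1 hR
  have hcyl : y ∈ {x : EuclideanSpace ℝ (Fin 3) | cylRadius x < 2 * b ∧ |x 2| < b} := ⟨hR', h2'⟩
  rw [indicator_of_mem hcyl]
  by_cases hcore : cylRadius y < b
  · -- the core `r < b`: `χ ≡ 1` near `q`, the rate IS the axial term
    have hq1 : q ∈ ball (0 : ℝ) χ.rIn := by
      rw [mem_ball, dist_zero_right, Real.norm_eq_abs, hχi, abs_of_nonneg (by rw [hq]; positivity), hq, div_lt_one hb2, ← hr2]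
      nlinarith
    have hc1 : χ q = 1 := χ.one_of_mem_closedBall (ball_subset_closedBall hq1)
    have hc' : deriv χ q = 0 := deriv_eq_zero_of_bump_mem_ball χ hq1
    rw [hc1, hc']
    have : deriv ζ (y 2 / b) * (v 2 / b) * 1 + ζ (y 2 / b) * (0 * ((2 * y 0 * v 0 + 2 * y 1 * v 1) / b ^ 2)) -
        1 / b * (deriv ζ (y 2 / b) * v 2) = 0 := by ring
    rw [this, abs_zero]
    exact hRHS0
  · -- the transition `b ≤ r < 2b`: both terms live in `cyl ∩ shell`
    have hcore' : b ≤ cylRadius y := not_lt.1 hcore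
    have hshell : y ∈ {x : EuclideanSpace ℝ (Fin 3) | x ∈ ball (0 : EuclideanSpace ℝ (Fin 3)) (3 * b) ∧ b ≤ cylRadius x} := by
      refine ⟨mem_ball_zero_iff.2 ?_, hcore'⟩
      have h5 : ‖y‖ ^ 2 < (3 * b) ^ 2 := by
        rw [hsq, ← hr2]
        have : y 2 ^ 2 < b ^ 2 := by
          calc y 2 ^ 2 = |y 2| ^ 2 := (sq_abs _).symm
            _ < b ^ 2 := pow_lt_pow_left₀ h2' (abs_nonneg _) two_ne_zero
        nlinarith
      exact (pow_lt_pow_iff_left₀ (norm_nonneg _) (by positivity) two_ne_zero).1 h5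
    rw [indicator_of_mem hshell]
    have e : deriv ζ (y 2 / b) * (v 2 / b) * χ q + ζ (y 2 / b) * (deriv χ q * ((2 * y 0 * v 0 + 2 * y 1 * v 1) / b ^ 2)) -
        1 / b * (deriv ζ (y 2 / b) * v 2) =
        deriv ζ (y 2 / b) * (v 2 / b) * (χ q - 1) + ζ (y 2 / b) * (deriv χ q * (2 * (y 0 * v 0 + y 1 * v 1) / b ^ 2)) := by ring
    rw [e]
    obtain ⟨hv2, -⟩ := coord_bounds v
    have hA : |deriv ζ (y 2 / b) * (v 2 / b) * (χ q - 1)| ≤ Cζ / b * ‖v‖ := by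
      rw [abs_mul, abs_mul, abs_div, abs_of_pos hb0]
      have h1 : |χ q - 1| ≤ 1 := by
        rw [abs_sub_comm, abs_of_nonneg (by linarith [χ.le_one (x := q)])]; linarith [χ.nonneg (x := q)]
      have hv2' : |v 2| / b ≤ ‖v‖ / b := div_le_div_of_nonneg_right hv2 hb0.le
      calc |deriv ζ (y 2 / b)| * (|v 2| / b) * |χ q - 1| ≤ Cζ * (‖v‖ / b) * 1 :=
            mul_le_mul (mul_le_mul (hCζ _) hv2' (by positivity) hCζ0) h1 (abs_nonneg _) (by positivity)
        _ = Cζ / b * ‖v‖ := by ring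
    have hB : |ζ (y 2 / b) * (deriv χ q * (2 * (y 0 * v 0 + y 1 * v 1) / b ^ 2))| ≤ 4 * Cχ / b * ‖v‖ := by
      rw [abs_mul, abs_mul, abs_div, abs_of_pos hb2, abs_mul, abs_of_pos (by norm_num : (0 : ℝ) < 2)]
      have hin := abs_horizontal_inner_le_cylRadius_mul y v
      have hζ1 : |ζ (y 2 / b)| ≤ 1 := by rw [abs_of_nonneg ζ.nonneg]; exact ζ.le_one
      have hin' : 2 * |y 0 * v 0 + y 1 * v 1| / b ^ 2 ≤ 2 * (2 * b * ‖v‖) / b ^ 2 := by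
        apply div_le_div_of_nonneg_right _ hb2.le
        have : cylRadius y * ‖v‖ ≤ 2 * b * ‖v‖ := mul_le_mul_of_nonneg_right hR'.le (norm_nonneg _)
        linarith
      calc |ζ (y 2 / b)| * (|deriv χ q| * (2 * |y 0 * v 0 + y 1 * v 1| / b ^ 2))
          ≤ 1 * (Cχ * (2 * (2 * b * ‖v‖) / b ^ 2)) :=
            mul_le_mul hζ1 (mul_le_mul (hCχ _) hin' (by positivity) hCχ0) (by positivity) zero_le_one
        _ = 4 * Cχ / b * ‖v‖ := by field_simp; ring
    calc |deriv ζ (y 2 / b) * (v 2 / b) * (χ q - 1) + ζ (y 2 / b) * (deriv χ q * (2 * (y 0 * v 0 + y 1 * v 1) / b ^ 2))|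
        ≤ Cζ / b * ‖v‖ + 4 * Cχ / b * ‖v‖ := (abs_add_le _ _).trans (add_le_add hA hB)
      _ = (Cζ + 4 * Cχ) / b * ‖v‖ := by ring

/-- **Crude bound on the rate**: `|∇ψ_b(y)·v| ≤ ((2C_ζ + 4C_χ)/b)‖v‖` (the axial term is `≤ (C_ζ/b)|v₂|`, plus the split). [folklore] -/
theorem abs_productCutoffRate_le (ζ χ : ContDiffBump (0 : ℝ)) (hζo : ζ.rOut = 1) (hχi : χ.rIn = 1)
    (hχo : χ.rOut = 4) {Cζ Cχ : ℝ} (hCζ : ∀ z, |deriv ζ z| ≤ Cζ) (hCχ : ∀ z, |deriv χ z| ≤ Cχ) {b : ℝ} (hb : 1 ≤ b)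
    (y v : EuclideanSpace ℝ (Fin 3)) :
    |deriv ζ (y 2 / b) * (v 2 / b) * χ ((y 0 ^ 2 + y 1 ^ 2) / b ^ 2) +
        ζ (y 2 / b) * (deriv χ ((y 0 ^ 2 + y 1 ^ 2) / b ^ 2) * ((2 * y 0 * v 0 + 2 * y 1 * v 1) / b ^ 2))| ≤
      (2 * Cζ + 4 * Cχ) / b * ‖v‖ := by
  have hb0 : 0 < b := by linarith
  have hCζ0 : 0 ≤ Cζ := (abs_nonneg _).trans (hCζ 0)
  have hCχ0 : 0 ≤ Cχ := (abs_nonneg _).trans (hCχ 0)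
  have hsplit := abs_productCutoffRate_sub_axial_le ζ χ hζo hχi hχo hCζ hCχ hb y v
  obtain ⟨hv2, -⟩ := coord_bounds v
  -- the axial term
  have hax : |(1 / b) * {x : EuclideanSpace ℝ (Fin 3) | cylRadius x < 2 * b ∧ |x 2| < b}.indicator (fun x => deriv ζ (x 2 / b) * v 2) y| ≤
      Cζ / b * ‖v‖ := by
    rw [abs_mul, abs_of_pos (by positivity : (0 : ℝ) < 1 / b)]
    have : |{x : EuclideanSpace ℝ (Fin 3) | cylRadius x < 2 * b ∧ |x 2| < b}.indicator (fun x => deriv ζ (x 2 / b) * v 2) y| ≤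
        Cζ * ‖v‖ := by
      by_cases hy : y ∈ {x : EuclideanSpace ℝ (Fin 3) | cylRadius x < 2 * b ∧ |x 2| < b}
      · rw [indicator_of_mem hy, abs_mul]
        exact mul_le_mul (hCζ _) hv2 (abs_nonneg _) hCζ0
      · rw [indicator_of_notMem hy, abs_zero]; positivity
    calc 1 / b * |{x : EuclideanSpace ℝ (Fin 3) | cylRadius x < 2 * b ∧ |x 2| < b}.indicator (fun x => deriv ζ (x 2 / b) * v 2) y|
        ≤ 1 / b * (Cζ * ‖v‖) := mul_le_mul_of_nonneg_left this (by positivity)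
      _ = Cζ / b * ‖v‖ := by ring
  -- the shell term
  have hsh : (Cζ + 4 * Cχ) / b *
      {x : EuclideanSpace ℝ (Fin 3) | x ∈ ball (0 : EuclideanSpace ℝ (Fin 3)) (3 * b) ∧ b ≤ cylRadius x}.indicator (fun _ => ‖v‖) y ≤
      (Cζ + 4 * Cχ) / b * ‖v‖ := by
    refine mul_le_mul_of_nonneg_left ?_ (by positivity)
    by_cases hy : y ∈ {x : EuclideanSpace ℝ (Fin 3) | x ∈ ball (0 : EuclideanSpace ℝ (Fin 3)) (3 * b) ∧ b ≤ cylRadius x}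
    · rw [indicator_of_mem hy]
    · rw [indicator_of_notMem hy]; exact norm_nonneg _
  have key := abs_sub_abs_le_abs_sub
    (deriv ζ (y 2 / b) * (v 2 / b) * χ ((y 0 ^ 2 + y 1 ^ 2) / b ^ 2) +
      ζ (y 2 / b) * (deriv χ ((y 0 ^ 2 + y 1 ^ 2) / b ^ 2) * ((2 * y 0 * v 0 + 2 * y 1 * v 1) / b ^ 2)))
    ((1 / b) * {x : EuclideanSpace ℝ (Fin 3) | cylRadius x < 2 * b ∧ |x 2| < b}.indicator (fun x => deriv ζ (x 2 / b) * v 2) y)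
  have : (2 * Cζ + 4 * Cχ) / b * ‖v‖ = Cζ / b * ‖v‖ + (Cζ + 4 * Cχ) / b * ‖v‖ := by ring
  rw [this]
  linarith

/-! ### The `ℝ≥0∞` change of variables of a ledger flow, as a push-forward identity -/

/-- If a measurable map `X` satisfies the `ℝ≥0∞` change of variables `∫⁻_{X '' S} g = ∫⁻_S g ∘ X` for every measurable `g`
(clause 6 of the line's `IsLedgerFlow`), then `X_* (vol⌊S) = vol⌊(X '' S)`. [folklore] -/
theorem map_restrict_eq_of_lintegral_comp {X : EuclideanSpace ℝ (Fin 3) → EuclideanSpace ℝ (Fin 3)} (hX : Measurable X)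
    {S : Set (EuclideanSpace ℝ (Fin 3))}
    (hcov : ∀ g : EuclideanSpace ℝ (Fin 3) → ℝ≥0∞, Measurable g → ∫⁻ x in X '' S, g x = ∫⁻ x in S, g (X x)) :
    Measure.map X (volume.restrict S) = volume.restrict (X '' S) := by
  ext A hA
  rw [Measure.map_apply hX hA, ← lintegral_indicator_one (hX hA), ← lintegral_indicator_one hA,
    hcov _ (measurable_one.indicator hA)]
  rfl

/-- The real-valued change of variables `∫_{X '' S} f = ∫_S f ∘ X` from the `ℝ≥0∞` one (push-forward identity + `integral_map`). [folklore] -/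
theorem setIntegral_image_eq_of_lintegral_comp {X : EuclideanSpace ℝ (Fin 3) → EuclideanSpace ℝ (Fin 3)} (hX : Measurable X)
    {S : Set (EuclideanSpace ℝ (Fin 3))}
    (hcov : ∀ g : EuclideanSpace ℝ (Fin 3) → ℝ≥0∞, Measurable g → ∫⁻ x in X '' S, g x = ∫⁻ x in S, g (X x))
    {f : EuclideanSpace ℝ (Fin 3) → ℝ} (hf : AEStronglyMeasurable f (volume.restrict (X '' S))) :
    ∫ x in X '' S, f x = ∫ x in S, f (X x) := by
  rw [← map_restrict_eq_of_lintegral_comp hX hcov] at hf ⊢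
  exact integral_map hX.aemeasurable hf

end Summit.NavierStokesRegularity.NavierStokesRegularity.Theorems.PowerGaugeEulerLiouville.CasimirHaul

end
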